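import Summits.AtomisticToContinuum.BoseEinsteinCondensation.Theses.BECInsertionCorrector
import Summits.AtomisticToContinuum.BoseEinsteinCondensation.Theorems.BECInsertionCorrectorResidueCondenses
import HarnessLib

/-!
# `CorrectorClosure` splits EXACTLY, modulo the route's own crux K1, into torus BEC (item 8997) and
# the BEC-conditional insertion residue (crux `BECInsertionCorrector.CorrectorClosure`,
# item stmt-AtomisticToContinuum-12058; strategist decomposition, glue for `route edit --split`)

`CorrectorClosure := StaticResponseBound → InsertionResidue`. Sixteen lead seats and seven registered
lines on this crux all ended at one wall — no `K1 ⇒ torus BEC` device in `d = 3` — and the landed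
reductions already bracket the crux: `CorrectorClosure → StaticResponseBound → PeriodicBEC-body`
(`ResidueCondenses_proof`, item 12059; `periodicBEC_of_correctorClosure`, p121285) and
`PeriodicBEC ∧ (K1 → removal fidelity) ∧ (hard-core case) → CorrectorClosure`
(`correctorClosure_of_periodicBEC`, p122159). This file types the split the leads asked for, in the one
form that is (i) glueable by modus ponens for EVERY admissible `v` (bounded or hard-core, no Feynman–Kac
frame, no shared near-minimiser window to align) and (ii) EXACT:

* child 1 — torus BEC of near-minimisers, VERBATIM the signature of item stmt-AtomisticToContinuum-8997
  `PeriodicBEC` (shared with six routes);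
* child 2 — `InsertionResidueOfBEC`: given K1, for each admissible `v`, torus BEC of the near-minimisers
  (the body of child 1 AT `v`) implies the insertion-residue floor (the body of `InsertionResidue` AT `v`):
  "no orthogonality catastrophe for inserting / removing a zero-momentum boson GIVEN the condensate" — the
  route-specific removal-fidelity content (`F = A/f₀ ≥ c₂` of `…FactorisationExact`; the dead stub R /
  S6 of the registered lines), now with BEC and K1 both available as hypotheses.

* `CorrectorClosure_of_subs` — child 1 → child 2 → `CorrectorClosure` BY NAME (the `--glue-by`).
* `insertionResidueOfBEC_of_correctorClosure` — child 2 is implied by the crux outright.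
* `correctorClosure_iff_of_staticResponseBound` — given K1 the crux is EQUIVALENT to child 1 ∧ child 2
  (child 1 by the landed necessity `ResidueCondenses_proof`). Nothing lost, nothing smuggled: under K1,
  refuting either child refutes the crux, and proving both proves it.

Pure logic over landed theorems; no new definitions (the children of the split are these hypothesis
types verbatim). [folklore]
-/

noncomputable section

open MeasureTheory Filter Matrix
open scoped ENNReal NNReal BigOperators ComplexConjugate

namespace Summit.AtomisticToContinuum.BoseEinsteinCondensation.Theorems.CorrectorClosure.Split

open Literature.MathematicalPhysics.QuantumManyBody.BoseGas
open Summit.AtomisticToContinuum.BoseEinsteinCondensation.Theses.BECInsertionCorrector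

/-- **`CorrectorClosure` from its two sub-cruxes, BY NAME.** Child 1: torus BEC of near-minimisers
(item stmt-AtomisticToContinuum-8997 `PeriodicBEC`, verbatim). Child 2 (`InsertionResidueOfBEC`): given
`StaticResponseBound`, for every admissible `v`, torus BEC of the near-minimisers for `v` implies the
insertion-residue floor for `v`. Glue: thread K1 into child 2 and feed it child 1 at `v`. [folklore] -/
theorem CorrectorClosure_of_subs
    (hP : ∀ v : ℝ → ℝ≥0∞, IsRepulsiveFiniteRange v →
      ∃ ρ₀ : ℝ, 0 < ρ₀ ∧ ∀ ρ : ℝ, 0 < ρ → ρ < ρ₀ → ∃ c : ℝ, 0 < c ∧ ∀ᶠ N : ℕ in Filter.atTop,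
        ∃ δ : ℝ≥0∞, 0 < δ ∧ ∀ Ψ : PeriodicTrialState N (sideLength ρ N),
          periodicEnergy v Ψ ≤ periodicGroundStateEnergy v N (sideLength ρ N) + δ →
          ENNReal.ofReal (c * N) ≤ condensateOccupation N (sideLength ρ N) Ψ.ψ)
    (hB : StaticResponseBound → ∀ v : ℝ → ℝ≥0∞, IsRepulsiveFiniteRange v →
      (∃ ρ₀ : ℝ, 0 < ρ₀ ∧ ∀ ρ : ℝ, 0 < ρ → ρ < ρ₀ → ∃ c : ℝ, 0 < c ∧ ∀ᶠ N : ℕ in Filter.atTop,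
        ∃ δ : ℝ≥0∞, 0 < δ ∧ ∀ Ψ : PeriodicTrialState N (sideLength ρ N),
          periodicEnergy v Ψ ≤ periodicGroundStateEnergy v N (sideLength ρ N) + δ →
          ENNReal.ofReal (c * N) ≤ condensateOccupation N (sideLength ρ N) Ψ.ψ) →
      ∃ ρ₀ : ℝ, 0 < ρ₀ ∧ ∀ ρ : ℝ, 0 < ρ → ρ < ρ₀ → ∃ c : ℝ, 0 < c ∧ ∀ᶠ N : ℕ in Filter.atTop,
        ∃ δ : ℝ≥0∞, 0 < δ ∧ ∃ Θ : PeriodicTrialState N (sideLength ρ (N + 1)),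
          periodicEnergy v Θ ≤ periodicGroundStateEnergy v N (sideLength ρ (N + 1)) + δ ∧
          ∀ Ψ : PeriodicTrialState (N + 1) (sideLength ρ (N + 1)),
            periodicEnergy v Ψ ≤ periodicGroundStateEnergy v (N + 1) (sideLength ρ (N + 1)) + δ →
            ENNReal.ofReal c ≤ ENNReal.ofReal ((sideLength ρ (N + 1) ^ 3)⁻¹) *
              (‖∫ X in cellN N (sideLength ρ (N + 1)), conj (Θ.ψ X) *
                  ∫ x in cell (sideLength ρ (N + 1)), Ψ.ψ (vecCons x X)‖₊ : ℝ≥0∞) ^ 2) :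
    CorrectorClosure :=
  fun hK1 v hv => hB hK1 v hv (hP v hv)

/-- **Necessity of child 2.** `CorrectorClosure` gives `InsertionResidueOfBEC` outright (discard the BEC
hypothesis). [folklore] -/
theorem insertionResidueOfBEC_of_correctorClosure (hCC : CorrectorClosure) :
    StaticResponseBound → ∀ v : ℝ → ℝ≥0∞, IsRepulsiveFiniteRange v →
      (∃ ρ₀ : ℝ, 0 < ρ₀ ∧ ∀ ρ : ℝ, 0 < ρ → ρ < ρ₀ → ∃ c : ℝ, 0 < c ∧ ∀ᶠ N : ℕ in Filter.atTop,
        ∃ δ : ℝ≥0∞, 0 < δ ∧ ∀ Ψ : PeriodicTrialState N (sideLength ρ N),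
          periodicEnergy v Ψ ≤ periodicGroundStateEnergy v N (sideLength ρ N) + δ →
          ENNReal.ofReal (c * N) ≤ condensateOccupation N (sideLength ρ N) Ψ.ψ) →
      ∃ ρ₀ : ℝ, 0 < ρ₀ ∧ ∀ ρ : ℝ, 0 < ρ → ρ < ρ₀ → ∃ c : ℝ, 0 < c ∧ ∀ᶠ N : ℕ in Filter.atTop,
        ∃ δ : ℝ≥0∞, 0 < δ ∧ ∃ Θ : PeriodicTrialState N (sideLength ρ (N + 1)),
          periodicEnergy v Θ ≤ periodicGroundStateEnergy v N (sideLength ρ (N + 1)) + δ ∧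
          ∀ Ψ : PeriodicTrialState (N + 1) (sideLength ρ (N + 1)),
            periodicEnergy v Ψ ≤ periodicGroundStateEnergy v (N + 1) (sideLength ρ (N + 1)) + δ →
            ENNReal.ofReal c ≤ ENNReal.ofReal ((sideLength ρ (N + 1) ^ 3)⁻¹) *
              (‖∫ X in cellN N (sideLength ρ (N + 1)), conj (Θ.ψ X) *
                  ∫ x in cell (sideLength ρ (N + 1)), Ψ.ψ (vecCons x X)‖₊ : ℝ≥0∞) ^ 2 :=
  fun hK1 v hv _ => hCC hK1 v hv

/-- **Exactness of the split modulo K1.** Given `StaticResponseBound` (the route's rank-2 crux, item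
stmt-AtomisticToContinuum-12057), `CorrectorClosure` is EQUIVALENT to (child 1 ∧ child 2): child 1 (torus
BEC, item 8997) is necessary by the landed `ResidueCondenses_proof` (item 12059), child 2 by
`insertionResidueOfBEC_of_correctorClosure`, and together they suffice by `CorrectorClosure_of_subs`.
[folklore] -/
theorem correctorClosure_iff_of_staticResponseBound (hK1 : StaticResponseBound) :
    CorrectorClosure ↔
      ((∀ v : ℝ → ℝ≥0∞, IsRepulsiveFiniteRange v →
        ∃ ρ₀ : ℝ, 0 < ρ₀ ∧ ∀ ρ : ℝ, 0 < ρ → ρ < ρ₀ → ∃ c : ℝ, 0 < c ∧ ∀ᶠ N : ℕ in Filter.atTop,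
          ∃ δ : ℝ≥0∞, 0 < δ ∧ ∀ Ψ : PeriodicTrialState N (sideLength ρ N),
            periodicEnergy v Ψ ≤ periodicGroundStateEnergy v N (sideLength ρ N) + δ →
            ENNReal.ofReal (c * N) ≤ condensateOccupation N (sideLength ρ N) Ψ.ψ) ∧
      (StaticResponseBound → ∀ v : ℝ → ℝ≥0∞, IsRepulsiveFiniteRange v →
        (∃ ρ₀ : ℝ, 0 < ρ₀ ∧ ∀ ρ : ℝ, 0 < ρ → ρ < ρ₀ → ∃ c : ℝ, 0 < c ∧ ∀ᶠ N : ℕ in Filter.atTop,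
          ∃ δ : ℝ≥0∞, 0 < δ ∧ ∀ Ψ : PeriodicTrialState N (sideLength ρ N),
            periodicEnergy v Ψ ≤ periodicGroundStateEnergy v N (sideLength ρ N) + δ →
            ENNReal.ofReal (c * N) ≤ condensateOccupation N (sideLength ρ N) Ψ.ψ) →
        ∃ ρ₀ : ℝ, 0 < ρ₀ ∧ ∀ ρ : ℝ, 0 < ρ → ρ < ρ₀ → ∃ c : ℝ, 0 < c ∧ ∀ᶠ N : ℕ in Filter.atTop,
          ∃ δ : ℝ≥0∞, 0 < δ ∧ ∃ Θ : PeriodicTrialState N (sideLength ρ (N + 1)),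
            periodicEnergy v Θ ≤ periodicGroundStateEnergy v N (sideLength ρ (N + 1)) + δ ∧
            ∀ Ψ : PeriodicTrialState (N + 1) (sideLength ρ (N + 1)),
              periodicEnergy v Ψ ≤ periodicGroundStateEnergy v (N + 1) (sideLength ρ (N + 1)) + δ →
              ENNReal.ofReal c ≤ ENNReal.ofReal ((sideLength ρ (N + 1) ^ 3)⁻¹) *
                (‖∫ X in cellN N (sideLength ρ (N + 1)), conj (Θ.ψ X) *
                    ∫ x in cell (sideLength ρ (N + 1)), Ψ.ψ (vecCons x X)‖₊ : ℝ≥0∞) ^ 2)) :=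
  ⟨fun hCC =>
    ⟨Summit.AtomisticToContinuum.BoseEinsteinCondensation.Theorems.ResidueCondenses_proof (hCC hK1),
      insertionResidueOfBEC_of_correctorClosure hCC⟩,
    fun h => CorrectorClosure_of_subs h.1 h.2⟩

end Summit.AtomisticToContinuum.BoseEinsteinCondensation.Theorems.CorrectorClosure.Split

end
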